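import Literature.NumberTheory.EllipticCurves.RationalPointRankTwoCriteria
import HarnessLib

/-!
# BirchSwinnertonDyer / CountingDoorF2AtThree — the reduction homomorphism of an INTEGER model at a
# good prime, read in `𝔽_ℓ = ZMod ℓ`, and two kernel certificates it feeds: torsion-freeness and the
# `3`-descent independence of two rational points

Route-free kernel file of cell bsd-rank2 (seat bsd-rank2-eng-2 GEN 3), `--supports` crux I1
`SelmerThreeAverageLargeF2` (stmt-BirchSwinnertonDyer-19440) of
`route-BirchSwinnertonDyer-CountingDoorF2AtThree`; consumed by the companion
`CountingDoorF2AtThreeMemberwiseGenericity.lean`, which proves `E(ℚ)_tors = 0 ∧ rank ≥ 2` for EVERY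
member of three congruence classes of Bhargava–Ho's `F₂` (the member-wise form of the fact pack
`LargeFamilyInputsF2`'s Thm. 10.1 conjunct on the door family). THEOREMS ONLY (no definition, no named
fact, no `sorry`; axioms `propext`, `Classical.choice`, `Quot.sound`).

* §1 `intModel_exists_reductionHom` — for `E : WeierstrassCurve ℤ` and a prime `ℓ ∤ Δ(E)`: a
  homomorphism `red : E(ℚ) →+ Ẽ(𝔽_ℓ)`, `Ẽ = E.map (ℤ → ZMod ℓ)`, with `red (x, y) = (x̄, ȳ)` on
  integral points and injective on the torsion of order prime to `ℓ` (Silverman *AEC* VII.2.1,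
  VII.3.1(b): the tree's `goodReductionHom` of the `ℤ_ℓ`-model — `GeomPointReduction` — composed with
  `E(ℚ) → E(ℚ_ℓ)` (`toPadicPoint`) and `ℤ_ℓ/ℓ ≅ 𝔽_ℓ` (`PadicInt.residueField`)). The group law on
  `Ẽ(𝔽_ℓ)` is read through `ZMod.decidableEq`, so identities `k • P̄ = Õ` are KERNEL-DECIDABLE
  (`decide +kernel` evaluates Mathlib's chord–tangent law over `ZMod ℓ`).
* §2 `intModel_torsionFree_of_reductions` (if every prime `q` misses `#Ẽ(𝔽_ℓ)` at some good `ℓ ≠ q`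
  then `E(ℚ)` is torsion-free), `linearIndependent_pair_of_three_descent` (pure group theory: in a
  torsion-free abelian group, `P, Q` are `ℤ`-independent once each representative `P`, `P+Q`, `P+2Q`,
  `Q` of `ℙ¹(𝔽₃)` satisfies `(#G/3) • f(u) ≠ 0` in some finite image `f : M →+ G`, `3 ∣ #G` — the
  reduction-map form of the tree's RED-pair checker `two_le_mordellWeilRank_of_redPair`),
  `torsionOrder_eq_one_of_forall_isOfFinAddOrder`.

PARTITION: none — r_an ≥ 2, summit axis S0 (D-0036(1) funded rung); TWIN (D-0056): n/a. B1 honesty: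
elementary reduction-mod-`ℓ` algebra of Weierstrass models; nothing here mentions a Selmer group, an
`L`-value, a height or an analytic rank.

References: J. H. Silverman, *The Arithmetic of Elliptic Curves*, 2nd ed., GTM 106 (2009), Prop.
VII.2.1, Prop. VII.3.1(b), Thm. VIII.6.7 [SilvermanAEC2009]; J. W. S. Cassels, *Lectures on Elliptic
Curves* (1991) §13 (descent by a prime) [folklore].
-/

set_option linter.dupNamespace false

noncomputable section

open scoped Classical
open WeierstrassCurve Literature.NumberTheory.EllipticCurves

namespace Summit.BirchSwinnertonDyer.BirchSwinnertonDyer.Theorems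

/-! ### §1 The reduction homomorphism `E(ℚ) → Ẽ(𝔽_ℓ)` of an integer model at a prime `ℓ ∤ Δ(E)` -/

/-- **The reduction homomorphism of an integer Weierstrass model at a good prime.** For
`E : WeierstrassCurve ℤ` and a prime `ℓ ∤ Δ(E)` there is a group homomorphism
`red : E(ℚ) → Ẽ(𝔽_ℓ)`, `Ẽ = E mod ℓ`, which (i) sends an integral point `(x, y)`, `x y : ℤ`, to
`(x̄, ȳ)` and (ii) is injective on the torsion of order prime to `ℓ`: if `n • P = O`, `ℓ ∤ n` and
`red P = Õ` then `P = O`. It is the tree's `goodReductionHom` of the `ℤ_ℓ`-model (Silverman, *AEC*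
VII.2.1: reduction is a homomorphism with kernel `E₁(ℚ_ℓ)`; VII.3.1(b): prime-to-`ℓ` torsion injects)
composed with `E(ℚ) → E(ℚ_ℓ)` and the identification `ℤ_ℓ/ℓ ≅ 𝔽_ℓ`.
[cite: SilvermanAEC2009, Prop. VII.2.1 and Prop. VII.3.1(b)] -/
theorem intModel_exists_reductionHom_aux (E : WeierstrassCurve ℤ) (ℓ : ℕ) [hℓ : Fact ℓ.Prime]
    [instℓ : DecidableEq (ZMod ℓ)] (hΔ : ¬ ((ℓ : ℤ) ∣ E.Δ)) :
    ∃ red : (E.map (Int.castRingHom ℚ)).toAffine.Point →+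
        (E.map (Int.castRingHom (ZMod ℓ))).toAffine.Point,
      (∀ (x y : ℤ) (h : (E.map (Int.castRingHom ℚ)).toAffine.Nonsingular (x : ℚ) (y : ℚ))
          (h' : (E.map (Int.castRingHom (ZMod ℓ))).toAffine.Nonsingular (x : ZMod ℓ) (y : ZMod ℓ)),
          red (.some _ _ h) = .some _ _ h') ∧
      (∀ (n : ℤ), ¬ ((ℓ : ℤ) ∣ n) → ∀ P : (E.map (Int.castRingHom ℚ)).toAffine.Point,
          n • P = 0 → red P = 0 → P = 0) := by
  -- the group law on `Ẽ(𝔽_ℓ)` is stated for an ARBITRARY `DecidableEq (ZMod ℓ)` (consumers decide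
  -- point identities by kernel computation with `ZMod.decidableEq`); the tree's `mapPointHom` carries the
  -- classical instance, to which we reduce (`DecidableEq` is a subsingleton).
  have hinst : instℓ = fun a b => Classical.propDecidable (a = b) := Subsingleton.elim _ _
  set W : WeierstrassCurve ℚ := E.map (Int.castRingHom ℚ) with hW
  set V : WeierstrassCurve ℤ_[ℓ] := E.map (Int.castRingHom ℤ_[ℓ]) with hV
  -- good reduction of the `ℤ_ℓ`-model
  have hVΔ : IsUnit V.Δ := by
    rw [hV, map_Δ, PadicInt.isUnit_iff]
    refine le_antisymm (PadicInt.norm_le_one _) (not_lt.1 fun hlt => hΔ ?_)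
    exact (PadicInt.norm_int_lt_one_iff_dvd _).1 hlt
  -- the three models agree
  have e₁ : W.baseChange ℚ_[ℓ] = V.baseChange ℚ_[ℓ] := by
    rw [hW, hV, baseChange, baseChange, map_map, map_map]
    exact congrArg E.map (RingHom.ext_int _ _)
  set φ : IsLocalRing.ResidueField ℤ_[ℓ] →+* ZMod ℓ :=
    (PadicInt.residueField (p := ℓ)).toRingHom with hφ
  have e₂ : (V.map (IsLocalRing.residue ℤ_[ℓ])).map φ = E.map (Int.castRingHom (ZMod ℓ)) := by
    rw [hV, map_map, map_map]
    exact congrArg E.map (RingHom.ext_int _ _)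
  set r := goodReductionHom V (padicInt_valuationIntegers ℓ) hVΔ with hr
  -- the map on points along `φ`, read with the instance `instℓ`
  obtain ⟨m, hm_some, hm_inj⟩ : ∃ m : (V.map (IsLocalRing.residue ℤ_[ℓ])).toAffine.Point →+
      ((V.map (IsLocalRing.residue ℤ_[ℓ])).map φ).toAffine.Point,
      (∀ (x y : IsLocalRing.ResidueField ℤ_[ℓ])
        (h : (V.map (IsLocalRing.residue ℤ_[ℓ])).toAffine.Nonsingular x y),
        ∃ h', m (.some _ _ h) = .some (φ x) (φ y) h') ∧ Function.Injective m := by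
    subst hinst
    exact ⟨(V.map (IsLocalRing.residue ℤ_[ℓ])).mapPointHom φ, fun x y h => ⟨_, mapPointHom_some _ φ h⟩,
      mapPointHom_injective _ φ⟩
  set red : W.toAffine.Point →+ (E.map (Int.castRingHom (ZMod ℓ))).toAffine.Point :=
    (Affine.Point.congrEquiv e₂).toAddMonoidHom.comp
      (m.comp (r.comp ((Affine.Point.congrEquiv e₁).toAddMonoidHom.comp (W.toPadicPoint ℓ))))
    with hred
  refine ⟨red, fun x y h h' => ?_, fun n hn P hnP hP => ?_⟩
  · -- value on an integral point
    have hxy : (V.baseChange ℚ_[ℓ]).toAffine.Nonsingular (algebraMap ℤ_[ℓ] ℚ_[ℓ] (x : ℤ_[ℓ]))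
        (algebraMap ℤ_[ℓ] ℚ_[ℓ] (y : ℤ_[ℓ])) := by
      have := e₁ ▸ nonsingular_ratCast (p := ℓ) h
      convert this using 1 <;> simp
    -- the reduced point is nonsingular (the reduced curve is elliptic)
    have hE : E.toAffine.Equation x y :=
      (Affine.map_equation E.toAffine (f := Int.castRingHom ℚ) Int.cast_injective x y).mp h.1
    have hns : (V.map (IsLocalRing.residue ℤ_[ℓ])).toAffine.Nonsingular
        (IsLocalRing.residue ℤ_[ℓ] (x : ℤ_[ℓ])) (IsLocalRing.residue ℤ_[ℓ] (y : ℤ_[ℓ])) := by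
      haveI := isElliptic_map_residue (W := V) hVΔ
      have hVeq : V.toAffine.Equation (x : ℤ_[ℓ]) (y : ℤ_[ℓ]) := by
        have := (Affine.Equation.map (Int.castRingHom ℤ_[ℓ]) hE)
        simpa [hV] using this
      have hred := Affine.Equation.map (IsLocalRing.residue ℤ_[ℓ]) hVeq
      exact (Affine.equation_iff_nonsingular_of_Δ_ne_zero
        ((V.map (IsLocalRing.residue ℤ_[ℓ])).isUnit_Δ.ne_zero)).mp hred
    have step₁ : (Affine.Point.congrEquiv e₁) (W.toPadicPoint ℓ (.some _ _ h)) = .some _ _ hxy := by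
      rw [toPadicPoint_some, Affine.Point.congrEquiv_some]
      exact point_some_congr (by simp) (by simp)
    have step₂ : r (.some _ _ hxy) = .some _ _ hns := by
      rw [hr, goodReductionHom_apply]
      exact reducePoint_some_algebraMap (padicInt_valuationIntegers ℓ).hom_inj hxy hns
    obtain ⟨h'', step₃⟩ := hm_some _ _ hns
    change (Affine.Point.congrEquiv e₂) (m
      (r ((Affine.Point.congrEquiv e₁) (W.toPadicPoint ℓ (.some _ _ h))))) = _
    rw [step₁, step₂, step₃, Affine.Point.congrEquiv_some]
    refine point_some_congr ?_ ?_
    · rw [hφ, ← RingHom.comp_apply, ← PadicInt.toZMod_eq_residueField_comp_residue, map_intCast]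
    · rw [hφ, ← RingHom.comp_apply, ← PadicInt.toZMod_eq_residueField_comp_residue, map_intCast]
  · -- injectivity on prime-to-`ℓ` torsion
    set P' := (Affine.Point.congrEquiv e₁) (W.toPadicPoint ℓ P) with hP'
    have hnP' : n • P' = 0 := by rw [hP', ← map_zsmul, ← map_zsmul, hnP, map_zero, map_zero]
    have hrP' : r P' = 0 := by
      have h0 : (Affine.Point.congrEquiv e₂) (m (r P')) = 0 := hP
      rw [AddEquiv.map_eq_zero_iff] at h0
      exact hm_inj (by rw [h0, map_zero])
    have hvn : NormedField.valuation (K := ℚ_[ℓ]) (n : ℚ_[ℓ]) = 1 := by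
      change ‖(n : ℚ_[ℓ])‖₊ = 1
      rw [← NNReal.coe_inj, coe_nnnorm, NNReal.coe_one]
      refine le_antisymm (Padic.norm_int_le_one n) (not_lt.1 fun hlt => hn ?_)
      exact Padic.norm_intCast_lt_one_iff.1 hlt
    have hP'0 : P' = 0 :=
      eq_zero_of_zsmul_eq_zero_of_goodReductionHom_eq_zero (padicInt_valuationIntegers ℓ) hVΔ
        hvn hnP' hrP'
    rw [hP', AddEquiv.map_eq_zero_iff] at hP'0
    rcases P with _ | ⟨x, y, hxy⟩
    · rfl
    · exfalso
      rw [toPadicPoint_some] at hP'0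
      exact absurd hP'0 (by rintro ⟨⟩)

/-- **The reduction homomorphism of an integer Weierstrass model at a good prime** (Silverman, *AEC*
VII.2.1, VII.3.1(b)), with the group law on `Ẽ(𝔽_ℓ)` read through the decidable equality of `ZMod ℓ`
(so that identities `k • P̄ = Õ` in `Ẽ(𝔽_ℓ)` are kernel-decidable): see `intModel_exists_reductionHom_aux`.
[cite: SilvermanAEC2009, Prop. VII.2.1 and Prop. VII.3.1(b)] -/
theorem intModel_exists_reductionHom (E : WeierstrassCurve ℤ) (ℓ : ℕ) [Fact ℓ.Prime]
    (hΔ : ¬ ((ℓ : ℤ) ∣ E.Δ)) :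
    ∃ red : (E.map (Int.castRingHom ℚ)).toAffine.Point →+
        @WeierstrassCurve.Affine.Point _ _ (E.map (Int.castRingHom (ZMod ℓ))).toAffine,
      (∀ (x y : ℤ) (h : (E.map (Int.castRingHom ℚ)).toAffine.Nonsingular (x : ℚ) (y : ℚ))
          (h' : (E.map (Int.castRingHom (ZMod ℓ))).toAffine.Nonsingular (x : ZMod ℓ) (y : ZMod ℓ)),
          red (.some _ _ h) = .some _ _ h') ∧
      (∀ (n : ℤ), ¬ ((ℓ : ℤ) ∣ n) → ∀ P : (E.map (Int.castRingHom ℚ)).toAffine.Point,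
          n • P = 0 → red P = 0 → P = 0) :=
  intModel_exists_reductionHom_aux E ℓ (instℓ := ZMod.decidableEq ℓ) hΔ

/-- The reduction `(x̄, ȳ)` of an integral point `(x, y)` of `E(ℚ)` at a prime `ℓ ∤ Δ(E)` is a
nonsingular point of `Ẽ = E mod ℓ` (the reduced cubic is an elliptic curve). [cite: SilvermanAEC2009, VII.2 and Prop. VII.5.1(a)] -/
theorem intModel_nonsingular_reduce (E : WeierstrassCurve ℤ) (ℓ : ℕ) [Fact ℓ.Prime]
    (hΔ : ¬ ((ℓ : ℤ) ∣ E.Δ)) (x y : ℤ)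
    (h : (E.map (Int.castRingHom ℚ)).toAffine.Nonsingular (x : ℚ) (y : ℚ)) :
    (E.map (Int.castRingHom (ZMod ℓ))).toAffine.Nonsingular (x : ZMod ℓ) (y : ZMod ℓ) := by
  have hE : E.toAffine.Equation x y :=
    (Affine.map_equation E.toAffine (f := Int.castRingHom ℚ) Int.cast_injective x y).mp h.1
  have hred : (E.map (Int.castRingHom (ZMod ℓ))).toAffine.Equation (x : ZMod ℓ) (y : ZMod ℓ) := by
    have := Affine.Equation.map (Int.castRingHom (ZMod ℓ)) hE
    simpa using this
  refine (Affine.equation_iff_nonsingular_of_Δ_ne_zero ?_).mp hred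
  rw [map_Δ, eq_intCast, Ne, ZMod.intCast_zmod_eq_zero_iff_dvd]
  exact_mod_cast hΔ

/-! ### §2 Torsion and independence from reductions (pure group theory + §1) -/

/-- **No rational torsion from reductions at good primes.** If for every prime `q` there is a good
prime `ℓ ≠ q` of the integer model `E` with `q ∤ #Ẽ(𝔽_ℓ)`, then `E(ℚ)` is torsion-free: a rational
point of prime order `q` reduces injectively (`ℓ ≠ q`, Silverman *AEC* VII.3.1(b)) to a point of order
`q` of `Ẽ(𝔽_ℓ)`, so `q ∣ #Ẽ(𝔽_ℓ)` (Lagrange). [cite: SilvermanAEC2009, Prop. VII.3.1(b)] -/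
theorem intModel_torsionFree_of_reductions (E : WeierstrassCurve ℤ)
    (hcover : ∀ q : ℕ, q.Prime → ∃ (ℓ : ℕ) (_ : Fact ℓ.Prime), ℓ ≠ q ∧ ¬ ((ℓ : ℤ) ∣ E.Δ) ∧
      ¬ (q ∣ Nat.card (E.map (Int.castRingHom (ZMod ℓ))).toAffine.Point))
    (T : (E.map (Int.castRingHom ℚ)).toAffine.Point) (hT : IsOfFinAddOrder T) : T = 0 := by
  by_contra hT0
  have hpos : 0 < addOrderOf T := addOrderOf_pos_iff.mpr hT
  have hne1 : addOrderOf T ≠ 1 := fun h1 => hT0 (AddMonoid.addOrderOf_eq_one_iff.mp h1)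
  obtain ⟨q, hq, hqdvd⟩ := Nat.exists_prime_and_dvd hne1
  obtain ⟨ℓ, hℓ, hℓq, hΔ, hcard⟩ := hcover q hq
  obtain ⟨red, -, hinj⟩ := intModel_exists_reductionHom E ℓ hΔ
  -- `T' = (ord T / q) • T` has order exactly `q`
  set T' := (addOrderOf T / q) • T with hT'def
  have hordT' : addOrderOf T' = q := addOrderOf_nsmul_addOrderOf_sub hpos.ne' hqdvd
  have hqT' : (q : ℤ) • T' = 0 := by
    rw [natCast_zsmul, ← hordT']; exact addOrderOf_nsmul_eq_zero T'
  have hℓq' : ¬ ((ℓ : ℤ) ∣ (q : ℤ)) := by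
    rw [Int.natCast_dvd_natCast]
    intro h
    exact hℓq ((Nat.prime_dvd_prime_iff_eq hℓ.out hq).mp h)
  -- its reduction is non-zero (prime-to-`ℓ` torsion injects) and is killed by `q`
  have hred0 : red T' ≠ 0 := by
    intro h0
    have := hinj q hℓq' T' hqT' h0
    rw [this, addOrderOf_zero] at hordT'
    exact hq.one_lt.ne hordT'
  have hordred : addOrderOf (red T') = q := by
    haveI : Fact q.Prime := ⟨hq⟩
    refine addOrderOf_eq_prime ?_ hred0
    rw [← natCast_zsmul, ← map_zsmul, hqT', map_zero]
  exact hcard (hordred ▸ addOrderOf_dvd_natCard (red T'))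

/-- Lagrange for a `3`-divisible element in a finite image: if `u = -3w` then `(#G/3) • f(u) = 0`
whenever `3 ∣ #G` (`#G • f(w) = 0`). [folklore] -/
theorem card_div_three_nsmul_map_eq_zero {M G : Type*} [AddCommGroup M] [AddCommGroup G]
    (f : M →+ G) (hG : 3 ∣ Nat.card G) {u w : M} (hu : u = -((3 : ℤ) • w)) :
    (Nat.card G / 3) • f u = 0 := by
  subst hu
  rw [map_neg, map_zsmul, smul_neg, neg_eq_zero, ofNat_zsmul, ← mul_nsmul', Nat.div_mul_cancel hG]
  exact card_nsmul_eq_zero'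

/-- **The `3`-descent independence certificate (pure group theory).** In a torsion-free abelian group
`M`, two elements `P, Q` are `ℤ`-linearly independent as soon as each of the four representatives
`P`, `P + Q`, `P + 2Q`, `Q` of `ℙ¹(𝔽₃)` is NOT divisible by `3` in some homomorphic image — here
certified in finite images `f_i : M → G_i` by `(#G_i / 3) • f_i(u) ≠ 0` with `3 ∣ #G_i` (if `u = 3w`
then `(#G_i/3) • f_i(u) = #G_i • f_i(w) = 0`, Lagrange): a dependency `sP + tQ = O` with
`gcd(s,t) = 1` (torsion-freeness removes the common factor) makes one representative `≡ 0 (mod 3M)`.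
This is the reduction-map form of the tree's RED-pair certificate
`two_le_mordellWeilRank_of_redPair` (Cassels, *LEC* §13; Silverman *AEC* VIII.6.7).
[cite: SilvermanAEC2009, Thm. VIII.6.7] -/
theorem linearIndependent_pair_of_three_descent {M G₀ G₁ G₂ G₃ : Type*} [AddCommGroup M]
    [AddCommGroup G₀] [AddCommGroup G₁] [AddCommGroup G₂] [AddCommGroup G₃]
    (htf : ∀ x : M, IsOfFinAddOrder x → x = 0) (P Q : M)
    (f₀ : M →+ G₀) (f₁ : M →+ G₁) (f₂ : M →+ G₂) (f₃ : M →+ G₃)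
    (h₀ : 3 ∣ Nat.card G₀) (h₀' : (Nat.card G₀ / 3) • f₀ P ≠ 0)
    (h₁ : 3 ∣ Nat.card G₁) (h₁' : (Nat.card G₁ / 3) • f₁ (P + Q) ≠ 0)
    (h₂ : 3 ∣ Nat.card G₂) (h₂' : (Nat.card G₂ / 3) • f₂ (P + 2 • Q) ≠ 0)
    (h₃ : 3 ∣ Nat.card G₃) (h₃' : (Nat.card G₃ / 3) • f₃ Q ≠ 0) :
    LinearIndependent ℤ ![P, Q] := by
  refine LinearIndependent.pair_iff.mpr fun s t hst => ?_
  by_contra hne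
  -- primitive part of `(s, t)`
  have hg : 0 < Int.gcd s t := by
    rcases not_and_or.mp hne with hs0 | ht0
    · exact Int.gcd_pos_of_ne_zero_left t hs0
    · exact Int.gcd_pos_of_ne_zero_right s ht0
  obtain ⟨s₁, t₁, hco1, hs, ht⟩ := Int.exists_gcd_one hg
  set g : ℕ := Int.gcd s t
  set v : M := s₁ • P + t₁ • Q with hvdef
  -- `g • v = 0`, so `v` is torsion, hence `v = 0`
  have hgv : (g : ℤ) • v = 0 := by
    have : (g : ℤ) • v = s • P + t • Q := by rw [hvdef, hs, ht]; module
    rw [this, hst]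
  have hv0 : v = 0 :=
    htf v (isOfFinAddOrder_iff_zsmul_eq_zero.mpr ⟨g, by exact_mod_cast hg.ne', hgv⟩)
  have hco1' : IsCoprime s₁ t₁ := Int.isCoprime_iff_gcd_eq_one.mpr hco1
  have hmP : Prime (3 : ℤ) := by norm_num
  by_cases hms : (3 : ℤ) ∣ s₁
  · -- `3 ∣ s₁`, hence `3 ∤ t₁`: the representative is `Q`
    obtain ⟨k, hk⟩ := hms
    have ht1 : IsCoprime t₁ (3 : ℤ) := by
      rw [hk] at hco1'
      exact (IsCoprime.of_mul_left_left hco1').symm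
    obtain ⟨μ, β, hμ⟩ := ht1
    have hrep : Q = μ • v - (3 : ℤ) • ((μ * k) • P - β • Q) := by
      rw [hvdef, hk]
      match_scalars
      · linear_combination -hμ
      · ring
    rw [hv0, smul_zero, zero_sub] at hrep
    exact h₃' (card_div_three_nsmul_map_eq_zero f₃ h₃ hrep)
  · -- `3 ∤ s₁`: the representative is `P + c • Q`, `c = (μ t₁) mod 3 ∈ {0, 1, 2}`
    have hs1 : IsCoprime s₁ (3 : ℤ) := (hmP.irreducible.coprime_iff_not_dvd.mpr hms).symm
    obtain ⟨μ, β, hμ⟩ := hs1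
    have hc₀ : μ * t₁ = 3 * (μ * t₁ / 3) + μ * t₁ % 3 := (Int.mul_ediv_add_emod _ _).symm
    have hrep : P + (μ * t₁ % 3) • Q = μ • v - (3 : ℤ) • ((-β) • P + (μ * t₁ / 3) • Q) := by
      rw [hvdef]
      match_scalars
      · linear_combination -hμ
      · linear_combination -hc₀
    rw [hv0, smul_zero, zero_sub] at hrep
    -- `c ∈ {0, 1, 2}`
    have hc3 : μ * t₁ % 3 = 0 ∨ μ * t₁ % 3 = 1 ∨ μ * t₁ % 3 = 2 := by omega
    rcases hc3 with hc | hc | hc <;> rw [hc] at hrep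
    · rw [zero_smul, add_zero] at hrep
      exact h₀' (card_div_three_nsmul_map_eq_zero f₀ h₀ hrep)
    · rw [one_smul] at hrep
      exact h₁' (card_div_three_nsmul_map_eq_zero f₁ h₁ hrep)
    · rw [ofNat_zsmul] at hrep
      exact h₂' (card_div_three_nsmul_map_eq_zero f₂ h₂ hrep)

/-- `#E(K)_tors = 1` when every point of finite order is `O` (the torsion subgroup is `⊥`).
Stated for a general field `K`, i.e. for the group law read through the classical `DecidableEq K`
as in the tree's `WeierstrassCurve.torsionOrder`. [folklore] -/
theorem torsionOrder_eq_one_of_forall_isOfFinAddOrder {K : Type*} [Field K] (W : WeierstrassCurve K)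
    (htf : ∀ T : W.toAffine.Point, IsOfFinAddOrder T → T = 0) : W.torsionOrder = 1 := by
  unfold WeierstrassCurve.torsionOrder
  rw [show AddCommGroup.torsion W.toAffine.Point = ⊥ from
    (AddSubgroup.eq_bot_iff_forall _).mpr fun T hT => htf T hT, AddSubgroup.card_bot]

end Summit.BirchSwinnertonDyer.BirchSwinnertonDyer.Theorems

end
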